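import Mathlib
import Summits.Ventures.PercRepro.TriangleCapTopEightWitnesses

/-!
# PercRepro — THE TOP EIGHT VALUES OF THE `K₄⁻`-FREE CHERRY TABLE: THE WHOLE `Δ = r − 2` BAND AND THE START OF
THE THIRD LAYER (p3, gen 50; part 218)

On the `a`-bipartite class the gap to the closed form is `2 M₂(H)` for the missing graph `H` (`r` edges), and the
top of the pair-count spectrum (part 213, `pair_count_spectrum`) puts `2 M₂` at `0`, `2 (r − 2) + 2 j` with `j ≤ 1`,
`4 (r − 3) + 2 j` with `j ≤ 3`, or `≥ 6 (r − 4)` (`r ≥ 8`) — `bipSub_gap_layers`.  Every value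
of the first three layers is attained on the cell (the witnesses of parts 208–218a).  Hence:

* `cherry_top_seven` (`r ≥ 10`, `6 (r − 4) ≤ stabGapFull k a r`): a `K₄⁻`-free graph on the cell strictly within
  `6 (r − 4)` of the closed form sits at one of the SEVEN values `closed − g`, `g ∈ {0, 2 (r − 2), 2 (r − 1), 4 (r − 3),
  4 (r − 3) + 2, 4 (r − 3) + 4, 4 (r − 3) + 6}`, and each of the seven is attained;
* `cherry_eighth_best` (`r ≥ 10`): a graph at none of the seven is at least `min (6 (r − 4)) (stabGapFull k a r)`
  below, and the value is attained (three pairs at the vertex `1` to three leaves, or the non-bipartite witness).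

Axioms: standard.
-/

namespace PercRepro

namespace TriangleCap

namespace C047

open Finset

variable {V : Type*} [Fintype V] [DecidableEq V]

/-- **THE GAP OF A BIPARTITE GRAPH IS A LAYER VALUE:** on the `a`-bipartite class (`r ≥ 8`, `r + 1 ≤ k`) the gap is
`0`, `2 (r − 2) + 2 j` (`j ≤ 1`), `4 (r − 3) + 2 j` (`j ≤ 3`), or `≥ 6 (r − 4)`. -/
theorem bipSub_gap_layers (D : SimpleGraph V) [DecidableRel D.Adj] (A : Finset V) (hD : BipSub D A) (a r : ℕ)
    (hA : A.card = a) (hm : D.edgeFinset.card + r = a * (Fintype.card V - a)) (hr : 8 ≤ r)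
    (hk : r + 1 ≤ Fintype.card V) :
    ∑ v, deg D v * deg D v + r * (Fintype.card V - 1 - r) = D.edgeFinset.card * Fintype.card V ∨
      (∃ j, j ≤ 1 ∧ ∑ v, deg D v * deg D v + r * (Fintype.card V - 1 - r) + (2 * (r - 2) + 2 * j) =
        D.edgeFinset.card * Fintype.card V) ∨
      (∃ j, j ≤ 3 ∧ ∑ v, deg D v * deg D v + r * (Fintype.card V - 1 - r) + (4 * (r - 3) + 2 * j) =
        D.edgeFinset.card * Fintype.card V) ∨
      ∑ v, deg D v * deg D v + r * (Fintype.card V - 1 - r) + 6 * (r - 4) ≤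
        D.edgeFinset.card * Fintype.card V := by
  have hH := bipSub_sum_deg_sq_add_disjEdgePairs D A hD a r hA hm hk
  have hr' : (missingGraph D A).edgeFinset.card = r := card_edges_missingGraph D A hD a r hA hm
  have hid := sum_deg_sq_add_disjEdgePairs (missingGraph D A)
  rw [hr'] at hid
  have hfree := cliqueFree_of_bipSub _ A (bipSub_missingGraph D A)
  rcases pair_count_spectrum (missingGraph D A) hfree r hr hr' with h | h | h | ⟨j, hj, h⟩ | h
  · left; omega
  · right; left
    exact ⟨0, by omega, by omega⟩
  · right; left
    exact ⟨1, by omega, by omega⟩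
  · right; right; left
    exact ⟨j, hj, by omega⟩
  · right; right; right; omega

/-- **THE TOP SEVEN VALUES OF THE CHERRY TABLE:** on every cell `(k, a, r)` with `3 ≤ a`, `10 ≤ r`, `2 a + r ≤ k`
(`r + 7 ≤ k` on the row `a = 3`) and `6 (r − 4) ≤ stabGapFull k a r`, a `K₄⁻`-free graph strictly within `6 (r − 4)`
of the closed form sits at one of the seven values `closed − g`, `g ∈ {0, 2 (r − 2), 2 (r − 1), 4 (r − 3),
4 (r − 3) + 2, 4 (r − 3) + 4, 4 (r − 3) + 6}`, and each of the seven is attained. -/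
theorem cherry_top_seven (k a r : ℕ) (ha3 : 3 ≤ a) (hr10 : 10 ≤ r) (hk : 2 * a + r ≤ k) (hk3 : a = 3 → r + 7 ≤ k)
    (hgap : 6 * (r - 4) ≤ stabGapFull k a r) :
    (∀ (D : SimpleGraph (Fin k)) [DecidableRel D.Adj], K4mFree D → D.edgeFinset.card + r = a * (k - a) →
        D.edgeFinset.card * k < ∑ v, deg D v * deg D v + r * (k - 1 - r) + 6 * (r - 4) →
        ∃ g ∈ ({0, 2 * (r - 2), 2 * (r - 1), 4 * (r - 3), 4 * (r - 3) + 2, 4 * (r - 3) + 4,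
          4 * (r - 3) + 6} : Finset ℕ),
          ∑ v, deg D v * deg D v + r * (k - 1 - r) + g = D.edgeFinset.card * k) ∧
      (∀ g ∈ ({0, 2 * (r - 2), 2 * (r - 1), 4 * (r - 3), 4 * (r - 3) + 2, 4 * (r - 3) + 4,
          4 * (r - 3) + 6} : Finset ℕ),
        ∃ (D : SimpleGraph (Fin k)) (_ : DecidableRel D.Adj), K4mFree D ∧ D.edgeFinset.card + r = a * (k - a) ∧
          ∑ v, deg D v * deg D v + r * (k - 1 - r) + g = D.edgeFinset.card * k) := by
  have hcard : Fintype.card (Fin k) = k := Fintype.card_fin k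
  refine ⟨?_, ?_⟩
  · intro D _ hK hm hlt
    have hbip : ∃ A : Finset (Fin k), A.card = a ∧ BipSub D A := by
      by_contra hnb
      have h := (stab_table_rows_ge_three k a r ha3 hk (by omega) hk3).1 D hK hm hnb
      omega
    obtain ⟨A, hA, hB⟩ := hbip
    have hl := bipSub_gap_layers D A hB a r hA (by rw [hcard]; exact hm) (by omega) (by rw [hcard]; omega)
    rw [hcard] at hl
    simp only [mem_insert, mem_singleton]
    rcases hl with h | ⟨j, hj, h⟩ | ⟨j, hj, h⟩ | h
    · exact ⟨0, by simp, by rw [add_zero]; exact h⟩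
    · interval_cases j
      · exact ⟨2 * (r - 2), by simp, by rw [mul_zero, add_zero] at h; exact h⟩
      · exact ⟨2 * (r - 1), by simp, by rw [mul_one] at h; omega⟩
    · interval_cases j
      · exact ⟨4 * (r - 3), by simp, by rw [mul_zero, add_zero] at h; exact h⟩
      · exact ⟨4 * (r - 3) + 2, by simp, by rw [mul_one] at h; exact h⟩
      · exact ⟨4 * (r - 3) + 4, by simp, by omega⟩
      · exact ⟨4 * (r - 3) + 6, by simp, by omega⟩
    · omega
  · intro g hg
    simp only [mem_insert, mem_singleton] at hg
    rcases hg with rfl | rfl | rfl | rfl | rfl | rfl | rfl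
    · have hK := k4mFree_bipMinusStar k a r
      have hE := card_edges_bipMinusStar k a r (by omega) (by omega)
      have hS := sum_deg_sq_bipMinusStar k a r (by omega) (by omega) (by omega)
      rw [hcard] at hS
      exact ⟨bipMinusStar k a r, inferInstance, hK, hE, by rw [add_zero]; exact hS⟩
    · obtain ⟨D, inst, A, hK, -, -, -, hE, hS⟩ := broom_value k a r (by omega) (by omega) (by omega)
      have hE' : D.edgeFinset.card + r = a * (k - a) := by
        have : r ≤ a * (k - a) := by
          have h2 : 1 * (k - a) ≤ a * (k - a) := Nat.mul_le_mul_right _ (by omega)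
          omega
        omega
      refine ⟨D, inst, hK, hE', ?_⟩
      rw [hE]
      exact hS
    · obtain ⟨hK, hE, hS⟩ := starPlusPair_value k a r (by omega) (by omega) (by omega)
      exact ⟨starPlusPair k a r (by omega), inferInstance, hK, hE, hS⟩
    · obtain ⟨hK, hE, hS⟩ := twoPairsAtLeaf_value k a r ha3 (by omega) (by omega) (by omega)
      exact ⟨twoPairsAtLeaf k a r (by omega) (by omega) (by omega), inferInstance, hK, hE, hS⟩
    · obtain ⟨hK, hE, hS⟩ := twoPairsAtTwoLeaves_value k a r ha3 (by omega) (by omega) (by omega)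
      exact ⟨twoPairsAtTwoLeaves k a r (by omega) (by omega) (by omega) (by omega), inferInstance, hK, hE, hS⟩
    · obtain ⟨hK, hE, hS⟩ := pairAtLeafPlusPair_value k a r ha3 (by omega) (by omega) (by omega)
      exact ⟨pairAtLeafPlusPair k a r (by omega) (by omega) (by omega), inferInstance, hK, hE, hS⟩
    · obtain ⟨hK, hE, hS⟩ := twoPairsOff_value k a r ha3 (by omega) (by omega) (by omega)
      exact ⟨twoPairsOff k a r (by omega) (by omega), inferInstance, hK, hE, hS⟩

/-- **THE EIGHTH-BEST VALUE OF THE CHERRY TABLE:** on every cell with `3 ≤ a`, `10 ≤ r`, `2 a + r ≤ k`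
(`r + 7 ≤ k` on the row `a = 3`), a `K₄⁻`-free graph at none of the seven top gaps is at least
`min (6 (r − 4)) (stabGapFull k a r)` below the closed form, and the value is attained (three pairs at the vertex
`1` to three leaves of the `(r − 3)`-star when `6 (r − 4) ≤ stabGapFull`, the non-bipartite witness otherwise). -/
theorem cherry_eighth_best (k a r : ℕ) (ha3 : 3 ≤ a) (hr10 : 10 ≤ r) (hk : 2 * a + r ≤ k)
    (hk3 : a = 3 → r + 7 ≤ k) :
    (∀ (D : SimpleGraph (Fin k)) [DecidableRel D.Adj], K4mFree D → D.edgeFinset.card + r = a * (k - a) →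
        (∀ g ∈ ({0, 2 * (r - 2), 2 * (r - 1), 4 * (r - 3), 4 * (r - 3) + 2, 4 * (r - 3) + 4,
          4 * (r - 3) + 6} : Finset ℕ), ∑ v, deg D v * deg D v + r * (k - 1 - r) + g ≠ D.edgeFinset.card * k) →
        ∑ v, deg D v * deg D v + r * (k - 1 - r) + min (6 * (r - 4)) (stabGapFull k a r) ≤
          D.edgeFinset.card * k) ∧
      ∃ (D : SimpleGraph (Fin k)) (_ : DecidableRel D.Adj), K4mFree D ∧ D.edgeFinset.card + r = a * (k - a) ∧
        ∑ v, deg D v * deg D v + r * (k - 1 - r) + min (6 * (r - 4)) (stabGapFull k a r) =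
          D.edgeFinset.card * k := by
  have hcard : Fintype.card (Fin k) = k := Fintype.card_fin k
  refine ⟨?_, ?_⟩
  · intro D _ hK hm hne
    by_cases hbip : ∃ A : Finset (Fin k), A.card = a ∧ BipSub D A
    · obtain ⟨A, hA, hB⟩ := hbip
      have hl := bipSub_gap_layers D A hB a r hA (by rw [hcard]; exact hm) (by omega) (by rw [hcard]; omega)
      rw [hcard] at hl
      have hmin := min_le_left (6 * (r - 4)) (stabGapFull k a r)
      simp only [mem_insert, mem_singleton, forall_eq_or_imp, forall_eq] at hne
      obtain ⟨h0, h1, h2, h3, h4, h5, h6⟩ := hne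
      rcases hl with h | ⟨j, hj, h⟩ | ⟨j, hj, h⟩ | h
      · omega
      · interval_cases j <;> omega
      · interval_cases j <;> omega
      · omega
    · have h := (stab_table_rows_ge_three k a r ha3 hk (by omega) hk3).1 D hK hm hbip
      have hmin := min_le_right (6 * (r - 4)) (stabGapFull k a r)
      omega
  · by_cases hle : 6 * (r - 4) ≤ stabGapFull k a r
    · rw [min_eq_left hle]
      obtain ⟨hK, hE, hS⟩ := threePairsAtVertex_value k a r (by omega) (by omega) (by omega) (by omega)
      exact ⟨threePairsAtVertex k a r (by omega) (by omega) (by omega) (by omega), inferInstance, hK, hE, hS⟩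
    · rw [min_eq_right (le_of_lt (not_le.mp hle))]
      obtain ⟨D, inst, hK, hE, -, hS⟩ := (stab_table_rows_ge_three k a r ha3 hk (by omega) hk3).2
      exact ⟨D, inst, hK, hE, hS⟩

end C047

end TriangleCap

end PercRepro
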